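import Summits.ValiantsHypothesis.ValiantsHypothesis.Theorems.SymPencilPerFourCoordinateRadical

/-!
# Route `SymPencil` — quantitative radical bound on a CROSS `row l ∪ column c`
# (`--supports` stmt-ValiantsHypothesis-5674 `SdcSuperquadratic`; rank side of the sizes `22 … 25`,
# the third case of the `7`-dimensional trichotomy of val-width-5676-p2 g3)

The cross `X_{lc}` = matrices supported on row `l` ∪ column `c` is a `7`-dimensional linear subspace
of `Sing Z(per_4)` not contained in any two-row / two-column block.  For `V ≤ X_{lc}` of dimension
`d` carrying, at every base point `u`, a `|ι|`-square expansion of the `s²`-coefficient of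
`per_4 (u + s y)`, again `2 d ≤ |ι| + 8` (`two_mul_finrank_le_card_add_eight_of_cross`); so the
full cross (`d = 7`) needs `|ι| ≥ 6` and a `6`-dimensional sub-cross needs `|ι| ≥ 4`.

Mechanism (canonical `l = c = 0`).  At `u = E₁₁ + E₂₂ + E₃₃` (the diagonal of the complementary
`3 × 3` block), `per_4 (u + s x) = s·x₀₀ + s²·G(x)` with `G(x) = Σ_{i=1}^{3} x_{0i} x_{i0}` for
`x ∈ X₀₀` (`eval_perPoly_diag_add_smul_of_cross`): `G` has rank `6` on the cross with radical
`K·E₀₀`.  The common kernel `N` of the `Λ_k` in `V` has `dim N ≥ d − |ι|`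
(`SymPencilPerFourCoordinateRadical.exists_commonKernel`); the polarisation of `G` maps `N` into the
annihilator of `V ⊕ W''` (`W''` = matrices vanishing on row `0` and column `0`, `dim W'' = 9`) with
kernel inside `K·E₀₀`, so `dim N ≤ (16 − d − 9) + 1 = 8 − d`.  Transport to `(l, c)` by the row
swap `(0 l)` and the column swap `(0 c)`.

Honest framing: helper inequalities only; no lower bound claimed here; the crux `SdcSuperquadratic`
and `VP ≠ VNP` are not moved.  No definitions, no named facts. [folklore]
-/

noncomputable section

-- single-conjunct layout: Sub = Summit, duplicated namespace component intended
set_option linter.dupNamespace false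

namespace Summit.ValiantsHypothesis.ValiantsHypothesis.Theorems.SymPencilPerFourCrossRadical

open MvPolynomial Module
open Literature.Computability.AlgebraicComplexity
open Summit.ValiantsHypothesis.ValiantsHypothesis.Theorems.SymPencilPerFourBlocks
open Summit.ValiantsHypothesis.ValiantsHypothesis.Theorems.SymPencilPerFourCoordinateRadical

variable {K : Type*} [Field K]

/-- **`per_4 (E₁₁ + E₂₂ + E₃₃ + s x)` on the cross `row 0 ∪ column 0`**: `s x₀₀ + s² Σ_i x_{0i} x_{i0}`.
[folklore] -/
theorem eval_perPoly_diag_add_smul_of_cross (x : Fin 4 × Fin 4 → K)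
    (hx : ∀ i j : Fin 4, i ≠ 0 → j ≠ 0 → x (i, j) = 0) (s : K) :
    eval ((fun p : Fin 4 × Fin 4 =>
        if p = (1, 1) then (1 : K) else if p = (2, 2) then 1 else if p = (3, 3) then 1 else 0) + s • x)
        (perPoly (Fin 4) K) =
      s * x (0, 0) + s ^ 2 * (x (0, 1) * x (1, 0) + x (0, 2) * x (2, 0) + x (0, 3) * x (3, 0)) := by
  have h11 := hx 1 1 (by decide) (by decide); have h12 := hx 1 2 (by decide) (by decide)
  have h13 := hx 1 3 (by decide) (by decide); have h21 := hx 2 1 (by decide) (by decide)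
  have h22 := hx 2 2 (by decide) (by decide); have h23 := hx 2 3 (by decide) (by decide)
  have h31 := hx 3 1 (by decide) (by decide); have h32 := hx 3 2 (by decide) (by decide)
  have h33 := hx 3 3 (by decide) (by decide)
  rw [eval_perPoly, Matrix.permanent_fin_four_row]
  simp only [Matrix.of_apply, Pi.add_apply, Pi.smul_apply, smul_eq_mul, Prod.mk.injEq,
    h11, h12, h13, h21, h22, h23, h31, h32, h33,
    show ((0 : Fin 4) = 1) = False by decide, show ((0 : Fin 4) = 2) = False by decide,
    show ((0 : Fin 4) = 3) = False by decide,
    show ((1 : Fin 4) = 2) = False by decide, show ((1 : Fin 4) = 3) = False by decide,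
    show ((2 : Fin 4) = 1) = False by decide,
    show ((2 : Fin 4) = 3) = False by decide,
    show ((3 : Fin 4) = 1) = False by decide, show ((3 : Fin 4) = 2) = False by decide,
    and_true, and_false, and_self, if_true, if_false, add_zero, zero_add,
    mul_zero, zero_mul, mul_one]
  ring

/-- The space of `4 × 4` matrices vanishing on row `0` and on column `0` has dimension `9`.
[folklore] -/
theorem finrank_rowZero_colZero :
    finrank K ↥(LinearMap.ker (LinearMap.funLeft K K fun j : Fin 4 => ((0 : Fin 4), j)) ⊓
      LinearMap.ker (LinearMap.funLeft K K fun i : Fin 4 => (i, (0 : Fin 4)))) = 9 := by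
  let ρ : (Fin 4 × Fin 4 → K) →ₗ[K] (Fin 4 → K) := LinearMap.funLeft K K fun j : Fin 4 => ((0 : Fin 4), j)
  let κ : (Fin 4 × Fin 4 → K) →ₗ[K] (Fin 4 → K) := LinearMap.funLeft K K fun i : Fin 4 => (i, (0 : Fin 4))
  have hρ : ∀ x j, ρ x j = x (0, j) := fun _ _ => rfl
  have hκ : ∀ x i, κ x i = x (i, 0) := fun _ _ => rfl
  -- `dim ker ρ = 12`
  have htop : (⊤ : Submodule K (Fin 4 × Fin 4 → K)).map ρ = ⊤ := by
    rw [eq_top_iff]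
    rintro v -
    refine ⟨fun p : Fin 4 × Fin 4 => if p.1 = 0 then v p.2 else 0, Submodule.mem_top, ?_⟩
    funext j; simp [hρ]
  have hker : finrank K ↥(LinearMap.ker ρ) = 12 := by
    have h := AlperBogartVelasco.finrank_eq_finrank_map_add_finrank_inf_ker
      (⊤ : Submodule K (Fin 4 × Fin 4 → K)) ρ
    rw [htop, finrank_top, finrank_top, top_inf_eq, finrank_fintype_fun_eq_card,
      finrank_fintype_fun_eq_card, Fintype.card_prod, Fintype.card_fin] at h
    omega
  -- `(ker ρ).map κ = {v | v 0 = 0}`, of dimension `3`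
  let π : (Fin 4 → K) →ₗ[K] K := LinearMap.proj 0
  have hπ : ∀ v, π v = v 0 := fun _ => rfl
  have hmap : (LinearMap.ker ρ).map κ = LinearMap.ker π := by
    apply le_antisymm
    · rintro _ ⟨x, hx, rfl⟩
      rw [SetLike.mem_coe, LinearMap.mem_ker] at hx
      rw [LinearMap.mem_ker, hπ, hκ]
      exact congr_fun hx 0
    · intro v hv
      rw [LinearMap.mem_ker, hπ] at hv
      refine ⟨fun p : Fin 4 × Fin 4 => if p.2 = 0 then v p.1 else 0, ?_, ?_⟩
      · rw [SetLike.mem_coe, LinearMap.mem_ker]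
        funext j
        by_cases hj : j = 0
        · subst hj; simp [hρ, hv]
        · simp [hρ, hj]
      · funext i; simp [hκ]
  have hπtop : LinearMap.range π = ⊤ := by
    rw [LinearMap.range_eq_top]
    intro a
    exact ⟨Pi.single 0 a, by simp [hπ]⟩
  have hkerπ : finrank K ↥(LinearMap.ker π) = 3 := by
    have h := π.finrank_range_add_finrank_ker
    rw [hπtop, finrank_top, Module.finrank_self, finrank_fintype_fun_eq_card, Fintype.card_fin] at h
    omega
  have h := AlperBogartVelasco.finrank_eq_finrank_map_add_finrank_inf_ker (LinearMap.ker ρ) κ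
  rw [hmap, hkerπ, hker] at h
  show finrank K ↥(LinearMap.ker ρ ⊓ LinearMap.ker κ) = 9
  omega

/-- **Non-degeneracy count on the cross (canonical `l = c = 0`).**  `V ≤ X₀₀`, `N ≤ V`, and
translation by `N` leaves `G(y) = Σ_{i ≥ 1} y_{0i} y_{i0}` unchanged on `V`: then `dim N + dim V ≤ 8`.
[folklore] -/
theorem finrank_add_finrank_le_eight_cross00 (V N : Submodule K (Fin 4 × Fin 4 → K))
    (hV : ∀ x ∈ V, ∀ i j : Fin 4, i ≠ 0 → j ≠ 0 → x (i, j) = 0) (hNV : N ≤ V)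
    (hrad : ∀ x₀ ∈ N, ∀ y ∈ V,
      (x₀ + y) (0, 1) * (x₀ + y) (1, 0) + (x₀ + y) (0, 2) * (x₀ + y) (2, 0) +
          (x₀ + y) (0, 3) * (x₀ + y) (3, 0) =
        y (0, 1) * y (1, 0) + y (0, 2) * y (2, 0) + y (0, 3) * y (3, 0)) :
    finrank K N + finrank K V ≤ 8 := by
  classical
  let B : (Fin 4 × Fin 4 → K) → (Fin 4 × Fin 4 → K) → K := fun x y =>
    x (0, 1) * y (1, 0) + x (0, 2) * y (2, 0) + x (0, 3) * y (3, 0) +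
      (y (0, 1) * x (1, 0) + y (0, 2) * x (2, 0) + y (0, 3) * x (3, 0))
  have hB : ∀ x y, B x y = x (0, 1) * y (1, 0) + x (0, 2) * y (2, 0) + x (0, 3) * y (3, 0) +
      (y (0, 1) * x (1, 0) + y (0, 2) * x (2, 0) + y (0, 3) * x (3, 0)) := fun x y => rfl
  let β : (Fin 4 × Fin 4 → K) →ₗ[K] Module.Dual K (Fin 4 × Fin 4 → K) :=
    LinearMap.mk₂ K B
      (fun x₁ x₂ y => by simp only [hB, Pi.add_apply]; ring)
      (fun c x y => by simp only [hB, Pi.smul_apply, smul_eq_mul]; ring)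
      (fun x y₁ y₂ => by simp only [hB, Pi.add_apply]; ring)
      (fun c x y => by simp only [hB, Pi.smul_apply, smul_eq_mul]; ring)
  have hβ : ∀ x y, β x y = B x y := fun x y => rfl
  have hz : ∀ x₀ ∈ N,
      x₀ (0, 1) * x₀ (1, 0) + x₀ (0, 2) * x₀ (2, 0) + x₀ (0, 3) * x₀ (3, 0) = 0 := fun x₀ hx₀ => by
    simpa using hrad x₀ hx₀ 0 V.zero_mem
  have hBV : ∀ x₀ ∈ N, ∀ y ∈ V, β x₀ y = 0 := by
    intro x₀ hx₀ y hy
    have h := hrad x₀ hx₀ y hy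
    have h0 := hz x₀ hx₀
    simp only [Pi.add_apply] at h
    rw [hβ, hB]
    linear_combination h - h0
  have hBW : ∀ x y : Fin 4 × Fin 4 → K, (∀ j, y (0, j) = 0) → (∀ i, y (i, 0) = 0) → β x y = 0 := by
    intro x y h0 h0'
    rw [hβ, hB]
    simp [h0, h0']
  -- `W''` = matrices vanishing on row `0` and column `0`: `dim W'' = 9`, `V ⊓ W'' = 0`
  let ρ : (Fin 4 × Fin 4 → K) →ₗ[K] (Fin 4 → K) := LinearMap.funLeft K K fun j : Fin 4 => ((0 : Fin 4), j)
  let κ : (Fin 4 × Fin 4 → K) →ₗ[K] (Fin 4 → K) := LinearMap.funLeft K K fun i : Fin 4 => (i, (0 : Fin 4))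
  let W'' : Submodule K (Fin 4 × Fin 4 → K) := LinearMap.ker ρ ⊓ LinearMap.ker κ
  have hW''mem : ∀ y ∈ W'', (∀ j, y (0, j) = 0) ∧ ∀ i, y (i, 0) = 0 := fun y hy => by
    simp only [W'', Submodule.mem_inf, LinearMap.mem_ker] at hy
    exact ⟨fun j => congr_fun hy.1 j, fun i => congr_fun hy.2 i⟩
  have hW'' : finrank K W'' = 9 := finrank_rowZero_colZero
  have hinf : V ⊓ W'' = ⊥ := by
    rw [eq_bot_iff]
    intro y hy
    obtain ⟨hyV, hyW⟩ := Submodule.mem_inf.1 hy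
    rw [Submodule.mem_bot]
    funext ⟨i, j⟩
    rw [Pi.zero_apply]
    by_cases hi : i = 0
    · subst hi; exact (hW''mem y hyW).1 j
    by_cases hj : j = 0
    · subst hj; exact (hW''mem y hyW).2 i
    exact hV y hyV i j hi hj
  have hsup : finrank K ↥(V ⊔ W'') = finrank K V + 9 := by
    have h := Submodule.finrank_sup_add_finrank_inf_eq V W''
    rw [hinf, finrank_bot, hW''] at h
    omega
  have hann : finrank K ↥(V ⊔ W'') + finrank K ↥((V ⊔ W'').dualAnnihilator) = 16 := by
    rw [Subspace.finrank_add_finrank_dualAnnihilator_eq, finrank_fintype_fun_eq_card,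
      Fintype.card_prod, Fintype.card_fin]
  let g : ↥N →ₗ[K] Module.Dual K (Fin 4 × Fin 4 → K) := β.comp N.subtype
  have hrange : LinearMap.range g ≤ (V ⊔ W'').dualAnnihilator := by
    rintro _ ⟨⟨x₀, hx₀⟩, rfl⟩
    rw [Submodule.mem_dualAnnihilator]
    intro w hw
    obtain ⟨y, hy, y', hy', rfl⟩ := Submodule.mem_sup.1 hw
    show β x₀ (y + y') = 0
    rw [map_add, hBV x₀ hx₀ y hy, hBW x₀ y' (hW''mem y' hy').1 (hW''mem y' hy').2, add_zero]
  -- the kernel of `g` lies in `K · E₀₀`: bound its dimension by `1`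
  let N₁ : Submodule K (Fin 4 × Fin 4 → K) := (LinearMap.ker g).map N.subtype
  have hN₁ : finrank K N₁ = finrank K ↥(LinearMap.ker g) := Submodule.finrank_map_subtype_eq _ _
  have hN₁mem : ∀ x₀ ∈ N₁, x₀ ∈ V ∧ ∀ y, β x₀ y = 0 := by
    rintro _ ⟨z, hz, rfl⟩
    refine ⟨hNV z.2, fun y => ?_⟩
    rw [SetLike.mem_coe, LinearMap.mem_ker] at hz
    exact LinearMap.congr_fun hz y
  let θ : ↥N₁ →ₗ[K] K :=
    (LinearMap.proj ((0 : Fin 4), (0 : Fin 4)) : (Fin 4 × Fin 4 → K) →ₗ[K] K).comp N₁.subtype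
  have hθ : ∀ z : ↥N₁, θ z = (z : Fin 4 × Fin 4 → K) (0, 0) := fun _ => rfl
  have hθker : LinearMap.ker θ = ⊥ := by
    rw [eq_bot_iff]
    rintro ⟨x₀, hx₀N₁⟩ hθ0
    rw [LinearMap.mem_ker, hθ] at hθ0
    obtain ⟨hx₀V, hgx⟩ := hN₁mem x₀ hx₀N₁
    have t1 := hgx (Pi.single (1, 0) 1); have t2 := hgx (Pi.single (2, 0) 1)
    have t3 := hgx (Pi.single (3, 0) 1); have s1 := hgx (Pi.single (0, 1) 1)
    have s2 := hgx (Pi.single (0, 2) 1); have s3 := hgx (Pi.single (0, 3) 1)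
    simp only [hβ, hB, Pi.single_apply, Prod.mk.injEq,
      show ((0 : Fin 4) = 1) = False by decide, show ((0 : Fin 4) = 2) = False by decide,
      show ((0 : Fin 4) = 3) = False by decide, show ((1 : Fin 4) = 0) = False by decide,
      show ((1 : Fin 4) = 2) = False by decide, show ((1 : Fin 4) = 3) = False by decide,
      show ((2 : Fin 4) = 0) = False by decide, show ((2 : Fin 4) = 1) = False by decide,
      show ((2 : Fin 4) = 3) = False by decide, show ((3 : Fin 4) = 0) = False by decide,
      show ((3 : Fin 4) = 1) = False by decide, show ((3 : Fin 4) = 2) = False by decide,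
      and_true, and_false, and_self, if_true, if_false, add_zero, zero_add,
      mul_one, one_mul, mul_zero, zero_mul] at t1 t2 t3 s1 s2 s3
    rw [Submodule.mem_bot, Subtype.ext_iff, Submodule.coe_mk, Submodule.coe_zero]
    have hcases : ∀ i : Fin 4, i = 0 ∨ i = 1 ∨ i = 2 ∨ i = 3 := by decide
    funext ⟨i, j⟩
    rw [Pi.zero_apply]
    by_cases hi : i = 0
    · subst hi
      rcases hcases j with rfl | rfl | rfl | rfl
      · exact hθ0
      · exact t1
      · exact t2
      · exact t3
    by_cases hj : j = 0
    · subst hj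
      rcases hcases i with rfl | rfl | rfl | rfl
      · exact absurd rfl hi
      · exact s1
      · exact s2
      · exact s3
    exact hV x₀ hx₀V i j hi hj
  have hkerle : finrank K ↥(LinearMap.ker g) ≤ 1 := by
    rw [← hN₁]
    have h := θ.finrank_range_add_finrank_ker
    rw [hθker, finrank_bot, add_zero] at h
    have h2 := (LinearMap.range θ).finrank_le
    rw [Module.finrank_self] at h2
    omega
  have hN : finrank K (LinearMap.range g) + finrank K ↥(LinearMap.ker g) = finrank K N :=
    g.finrank_range_add_finrank_ker
  have hle : finrank K (LinearMap.range g) ≤ finrank K ↥((V ⊔ W'').dualAnnihilator) :=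
    Submodule.finrank_mono hrange
  omega

/-- **Canonical cross, one base point.**  `V ≤ X₀₀`; if at `u = E₁₁ + E₂₂ + E₃₃` the
`s²`-coefficient along `V` is `Σ_{k ∈ ι} c_k (Λ_k x)²`, then `2 dim V ≤ |ι| + 8`. [folklore] -/
theorem two_mul_finrank_le_cross00 [CharZero K] {ι : Type*} [Fintype ι]
    (V : Submodule K (Fin 4 × Fin 4 → K)) (hV : ∀ x ∈ V, ∀ i j : Fin 4, i ≠ 0 → j ≠ 0 → x (i, j) = 0)
    (c : ι → K) (Λ : ι → ((Fin 4 × Fin 4 → K) →ₗ[K] K))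
    (he : ∀ x ∈ V, ∃ e₀ e₁ : K, ∀ s : K,
      eval ((fun p : Fin 4 × Fin 4 =>
          if p = (1, 1) then (1 : K) else if p = (2, 2) then 1 else if p = (3, 3) then 1 else 0) +
          s • x) (perPoly (Fin 4) K) = e₀ + s * e₁ + s ^ 2 * ∑ k, c k * (Λ k x) ^ 2) :
    2 * finrank K V ≤ Fintype.card ι + 8 := by
  have he₂ : ∀ x ∈ V, ∑ k, c k * (Λ k x) ^ 2 =
      x (0, 1) * x (1, 0) + x (0, 2) * x (2, 0) + x (0, 3) * x (3, 0) := by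
    intro x hx
    obtain ⟨e₀, e₁, h⟩ := he x hx
    have P : ∀ s : K, e₀ + s * e₁ + s ^ 2 * ∑ k, c k * (Λ k x) ^ 2 =
        s * x (0, 0) + s ^ 2 * (x (0, 1) * x (1, 0) + x (0, 2) * x (2, 0) + x (0, 3) * x (3, 0)) :=
      fun s => by rw [← h s, eval_perPoly_diag_add_smul_of_cross x (hV x hx)]
    have h0 := P 0; have h1 := P 1; have h1' := P (-1)
    have h2 : (2 : K) * ∑ k, c k * (Λ k x) ^ 2 =
        2 * (x (0, 1) * x (1, 0) + x (0, 2) * x (2, 0) + x (0, 3) * x (3, 0)) := by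
      linear_combination h1 + h1' - 2 * h0
    exact (mul_right_inj' two_ne_zero).1 h2
  obtain ⟨N, hNV, hdim, hN⟩ := exists_commonKernel V Λ
  have hrad : ∀ x₀ ∈ N, ∀ y ∈ V,
      (x₀ + y) (0, 1) * (x₀ + y) (1, 0) + (x₀ + y) (0, 2) * (x₀ + y) (2, 0) +
          (x₀ + y) (0, 3) * (x₀ + y) (3, 0) =
        y (0, 1) * y (1, 0) + y (0, 2) * y (2, 0) + y (0, 3) * y (3, 0) := by
    intro x₀ hx₀ y hy
    rw [← he₂ y hy, ← he₂ (x₀ + y) (V.add_mem (hNV hx₀) hy)]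
    refine Finset.sum_congr rfl fun k _ => ?_
    rw [map_add, hN x₀ hx₀ k, zero_add]
  have h8 := finrank_add_finrank_le_eight_cross00 V N hV hNV hrad
  omega

/-- **A cross `row l ∪ column c`.**  If `V ≤ X_{lc}` carries, for every base point `u`, an
expansion of the `s²`-coefficient of `per_4 (u + s y)` as `|ι|` weighted squares of linear forms,
then `2 dim V ≤ |ι| + 8`.  (`V = X_{lc}`, `d = 7`: `|ι| ≥ 6`; `6`-dimensional sub-crosses:
`|ι| ≥ 4`.) [folklore] -/
theorem two_mul_finrank_le_card_add_eight_of_cross [CharZero K] {ι : Type*} [Fintype ι]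
    (V : Submodule K (Fin 4 × Fin 4 → K))
    (hX : ∃ l c : Fin 4, ∀ x ∈ V, ∀ i j : Fin 4, i ≠ l → j ≠ c → x (i, j) = 0)
    (hform : ∀ u : Fin 4 × Fin 4 → K, ∃ (c : ι → K) (Λ : ι → ((Fin 4 × Fin 4 → K) →ₗ[K] K)),
      ∀ y ∈ V, ∃ e₀ e₁ : K, ∀ s : K,
        eval (u + s • y) (perPoly (Fin 4) K) = e₀ + s * e₁ + s ^ 2 * ∑ k, c k * (Λ k y) ^ 2) :
    2 * finrank K V ≤ Fintype.card ι + 8 := by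
  obtain ⟨l, c₀, hX⟩ := hX
  set σ : Equiv.Perm (Fin 4) := Equiv.swap (0 : Fin 4) l with hσ
  set τ : Equiv.Perm (Fin 4) := Equiv.swap (0 : Fin 4) c₀ with hτ
  have hσ0 : σ 0 = l := by rw [hσ, Equiv.swap_apply_left]
  have hτ0 : τ 0 = c₀ := by rw [hτ, Equiv.swap_apply_left]
  set e := Equiv.prodCongr σ τ with he
  set Φ : (Fin 4 × Fin 4 → K) ≃ₗ[K] (Fin 4 × Fin 4 → K) := LinearEquiv.funCongrLeft K K e with hΦ
  have hΦa : ∀ (x : Fin 4 × Fin 4 → K) (i j : Fin 4), Φ x (i, j) = x (σ i, τ j) := fun x i j => by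
    simp [hΦ, he]
  have hΦper : ∀ z, eval (Φ z) (perPoly (Fin 4) K) = eval z (perPoly (Fin 4) K) := fun z => by
    have : (Φ z : Fin 4 × Fin 4 → K) = z ∘ e := rfl
    rw [this, he, eval_perPoly_comp_prodCongr]
  have hform' := sqFamily_map V Φ hΦper hform
  set V' := V.map Φ.toLinearMap with hV'def
  have hfin : finrank K V' = finrank K V := by rw [hV'def, LinearEquiv.finrank_map_eq]
  have hV' : ∀ y ∈ V', ∀ i j : Fin 4, i ≠ 0 → j ≠ 0 → y (i, j) = 0 := by
    rintro _ ⟨x, hx, rfl⟩ i j hi hj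
    rw [LinearEquiv.coe_toLinearMap, hΦa]
    refine hX x hx (σ i) (τ j) (fun h => hi (σ.injective ?_)) (fun h => hj (τ.injective ?_))
    · rw [h, hσ0]
    · rw [h, hτ0]
  obtain ⟨c, Λ, he'⟩ := hform' (fun p : Fin 4 × Fin 4 =>
    if p = (1, 1) then (1 : K) else if p = (2, 2) then 1 else if p = (3, 3) then 1 else 0)
  have h := two_mul_finrank_le_cross00 V' hV' c Λ he'
  omega

/-- **Negative, fixed-weights form** (the shape of `H7ₖ`, `H6ₖ` in
`SymPencilSdcPerFourLadder.le_of_noSqFamily`): a `d`-dimensional `V` inside a cross with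
`|ι| + 8 < 2 d` carries no `|ι|`-square family. [folklore] -/
theorem not_sqFamily_of_cross [CharZero K] {ι : Type*} [Fintype ι]
    (V : Submodule K (Fin 4 × Fin 4 → K))
    (hX : ∃ l c : Fin 4, ∀ x ∈ V, ∀ i j : Fin 4, i ≠ l → j ≠ c → x (i, j) = 0)
    (hlt : Fintype.card ι + 8 < 2 * finrank K V) (c : ι → K) :
    ¬ (∀ u : Fin 4 × Fin 4 → K, ∃ Λ : ι → ((Fin 4 × Fin 4 → K) →ₗ[K] K),
        ∀ y ∈ V, ∃ e₀ e₁ : K, ∀ s : K,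
          eval (u + s • y) (perPoly (Fin 4) K) = e₀ + s * e₁ + s ^ 2 * ∑ k, c k * (Λ k y) ^ 2) :=
  fun h => absurd (two_mul_finrank_le_card_add_eight_of_cross V hX fun u => by
    obtain ⟨Λ, hΛ⟩ := h u
    exact ⟨c, Λ, hΛ⟩) (not_le.2 hlt)

end Summit.ValiantsHypothesis.ValiantsHypothesis.Theorems.SymPencilPerFourCrossRadical

end
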